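import Mathlib
import HarnessLib
import Literature.MathematicalPhysics.StatisticalMechanics.ReblockingDecomposition
import Literature.MathematicalPhysics.StatisticalMechanics.RenormalisationStepLocality
import Literature.MathematicalPhysics.StatisticalMechanics.FiniteRangeFactorisation
import Literature.MathematicalPhysics.StatisticalMechanics.HigherDerivativeForms

/-!
# Factorisation of the renormalised perturbation over strictly disjoint polymers
# ([ABKM19] Lemma 6.4 (5))

[ABKM19] Lemma 6.4 (5): if `K ∈ M(𝓟_k)` factors on scale `k`,
`K(X₁ ∪ X₂) = K(X₁) K(X₂)` for strictly disjoint `X₁, X₂ ∈ 𝓟_k`, then `K_{k+1}` of (6.34) factors on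
scale `k+1`, `K_{k+1}(U₁ ∪ U₂) = K_{k+1}(U₁) K_{k+1}(U₂)` for strictly disjoint `U₁, U₂ ∈ 𝓟_{k+1}`,
provided `L` is so large that `dist(U₁*, U₂*)` exceeds the range of `μ_{k+1}` ((6.21), (6.37)).
The proof combines: the circle products in `Φ = J̃ ∘ (I − 1) ∘ K` factor over separated unions
((6.36)); the fluctuation integral factorises by the finite-range property ((6.38),
`integral_stepMeasure_mul_eq`) because `Φ(X_i, φ, ·)` depends only on the gradient of `ξ` near
`X_i*`; the prefactors split ((6.39)); and the sum over `{X : π(X) = U₁ ∪ U₂}` is the double sum over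
the unique decompositions `X = X₁ ⊔ X₂`, `π(X_i) = U_i` (`ReblockingDecomposition.sum_reblock_eq_union`).

* `pcirc_union_of_mul` — circle products factor over disjoint unions for cross-multiplicative
  functionals; `midK_union` — `Φ(X₁ ∪ X₂) = Φ(X₁) Φ(X₂)`;
* `isGaugeLocal_midK_snd` — gauge-locality of `ξ ↦ Φ(X, φ, ξ)`; `fieldGauge_eq_of_eqOn_thicken`,
  `fieldGauge_add_const`, `IsGaugeLocal.eq_of_eqOn_thicken`, `IsGaugeLocal.add_const` — a
  gauge-local functional depends only on the field on `S + [−p,p]^d` and is shift invariant;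
* `measurable_midK_snd` — measurability in `ξ`;
* **`nextK_union`** — Lemma 6.4 (5) for the reblocking map `π = reblock s (L s)` and the step
  measure `stepMeasure 𝒞` of a finite-range kernel, with explicit radii conditions
  (`2r' + 2 ≤ D`, `2r' + s + 1 ≤ D`, `2r' + 2p + ρ ≤ D` where `dist(U₁,U₂) ≥ D`, `r'` the radius of
  `U*`, `ρ` the range, `p` the gauge order).

Everything is proved; no named fact.

## References
* S. Adams, S. Buchholz, R. Kotecký, S. Müller, arXiv:1910.13564, Lemma 6.4 (5) and its proof,
  (6.21), (6.36)–(6.39) [AdamsBuchholzKoteckyMuller2019].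
-/

noncomputable section

namespace Literature.MathematicalPhysics.StatisticalMechanics.GradientRG

open scoped BigOperators Classical
open Finset MeasureTheory
open Literature.MathematicalPhysics.StatisticalMechanics.TorusPolymer
  hiding translate translate_translate translate_zero translate_empty translate_union translate_sdiff
    translate_inj translate_biUnion translate_subset_translate_iff mem_translate add_mem_translate_iff
    card_translate
open Literature.MathematicalPhysics.StatisticalMechanics.GradientFRD (iterDiff)

variable {d M : ℕ} [NeZero M] {𝕜 : Type*} [RCLike 𝕜]

/-! ## Circle products factor over disjoint unions ((6.36)) -/

/-- For disjoint polymers the polymer subsets of `X₁ ∪ X₂` are the unions `Y₁ ∪ Y₂`, `Y_i ∈ 𝓟_k(X_i)`: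
a sum over `𝓟_k(X₁ ∪ X₂)` is a double sum. [cite: AdamsBuchholzKoteckyMuller2019, Lemma 6.4 (5) (6.36)] -/
theorem sum_polys_union {s : ℕ} {X₁ X₂ : Finset (Fin d → ZMod M)} (hX₁ : IsPolymer s X₁)
    (hX₂ : IsPolymer s X₂) (hdis : Disjoint X₁ X₂) {A : Type*} [AddCommMonoid A]
    (f : Finset (Fin d → ZMod M) → A) :
    ∑ Y ∈ polys s (X₁ ∪ X₂), f Y = ∑ Y₁ ∈ polys s X₁, ∑ Y₂ ∈ polys s X₂, f (Y₁ ∪ Y₂) := by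
  rw [← Finset.sum_product' (f := fun Y₁ Y₂ => f (Y₁ ∪ Y₂))]
  symm
  refine Finset.sum_nbij' (fun p => p.1 ∪ p.2) (fun Y => (Y ∩ X₁, Y ∩ X₂)) ?_ ?_ ?_ ?_ ?_
  · rintro ⟨Y₁, Y₂⟩ hp
    rw [Finset.mem_product] at hp
    obtain ⟨h1, h2⟩ := hp
    exact mem_polys.2 ⟨union_subset_union (mem_polys.1 h1).1 (mem_polys.1 h2).1,
      (mem_polys.1 h1).2.union (mem_polys.1 h2).2⟩
  · intro Y hY
    obtain ⟨hYX, hYp⟩ := mem_polys.1 hY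
    rw [Finset.mem_product]
    exact ⟨mem_polys.2 ⟨inter_subset_right, hYp.inter hX₁⟩, mem_polys.2 ⟨inter_subset_right, hYp.inter hX₂⟩⟩
  · rintro ⟨Y₁, Y₂⟩ hp
    rw [Finset.mem_product] at hp
    obtain ⟨h1, h2⟩ := hp
    have hY₁ := (mem_polys.1 h1).1
    have hY₂ := (mem_polys.1 h2).1
    ext1
    · show (Y₁ ∪ Y₂) ∩ X₁ = Y₁
      rw [union_inter_distrib_right, inter_eq_left.2 hY₁,
        disjoint_iff_inter_eq_empty.1 (disjoint_of_subset_left hY₂ hdis.symm), union_empty]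
    · show (Y₁ ∪ Y₂) ∩ X₂ = Y₂
      rw [union_inter_distrib_right, inter_eq_left.2 hY₂,
        disjoint_iff_inter_eq_empty.1 (disjoint_of_subset_left hY₁ hdis), empty_union]
  · intro Y hY
    obtain ⟨hYX, -⟩ := mem_polys.1 hY
    show Y ∩ X₁ ∪ Y ∩ X₂ = Y
    rw [← inter_union_distrib_left, inter_eq_left.2 hYX]
  · intro Y hY; rfl

/-- **Circle products factor over disjoint unions** for cross-multiplicative functionals:
`(F ∘ G)(X₁ ∪ X₂) = (F ∘ G)(X₁) (F ∘ G)(X₂)` if `F(Y₁ ∪ Y₂) = F(Y₁)F(Y₂)` and likewise for `G` for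
all `Y_i ∈ 𝓟_k(X_i)`. [cite: AdamsBuchholzKoteckyMuller2019, Lemma 6.4 (5) (6.36)] -/
theorem pcirc_union_of_mul {s : ℕ} {X₁ X₂ : Finset (Fin d → ZMod M)} (hX₁ : IsPolymer s X₁)
    (hX₂ : IsPolymer s X₂) (hdis : Disjoint X₁ X₂) {F G : Finset (Fin d → ZMod M) → 𝕜}
    (hF : ∀ Y₁ ∈ polys s X₁, ∀ Y₂ ∈ polys s X₂, F (Y₁ ∪ Y₂) = F Y₁ * F Y₂)
    (hG : ∀ Y₁ ∈ polys s X₁, ∀ Y₂ ∈ polys s X₂, G (Y₁ ∪ Y₂) = G Y₁ * G Y₂) :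
    pcirc s F G (X₁ ∪ X₂) = pcirc s F G X₁ * pcirc s F G X₂ := by
  rw [pcirc, sum_polys_union hX₁ hX₂ hdis, pcirc, pcirc, Finset.sum_mul_sum]
  refine Finset.sum_congr rfl fun Y₁ hY₁ => Finset.sum_congr rfl fun Y₂ hY₂ => ?_
  have hY₁X := (mem_polys.1 hY₁).1
  have hY₂X := (mem_polys.1 hY₂).1
  have hsd : (X₁ ∪ X₂) \ (Y₁ ∪ Y₂) = (X₁ \ Y₁) ∪ (X₂ \ Y₂) := by
    ext x
    simp only [mem_sdiff, mem_union]
    constructor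
    · rintro ⟨h1 | h2, hn⟩
      · exact Or.inl ⟨h1, fun h => hn (Or.inl h)⟩
      · exact Or.inr ⟨h2, fun h => hn (Or.inr h)⟩
    · rintro (⟨h1, hn⟩ | ⟨h2, hn⟩)
      · exact ⟨Or.inl h1, fun h => h.elim hn fun h' => Finset.disjoint_left.1 hdis h1 (hY₂X h')⟩
      · exact ⟨Or.inr h2, fun h => h.elim (fun h' => Finset.disjoint_left.1 hdis (hY₁X h') h2) hn⟩
  rw [hsd, hF Y₁ hY₁ Y₂ hY₂, hG (X₁ \ Y₁) (mem_polys.2 ⟨sdiff_subset, hX₁.sdiff (mem_polys.1 hY₁).2⟩)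
    (X₂ \ Y₂) (mem_polys.2 ⟨sdiff_subset, hX₂.sdiff (mem_polys.1 hY₂).2⟩)]
  ring

/-- Block products are cross-multiplicative over disjoint polymers.
[cite: AdamsBuchholzKoteckyMuller2019, Lemma 6.4 (5) (6.36)] -/
theorem bprod_union_of_mem_polys {s : ℕ} {X₁ X₂ : Finset (Fin d → ZMod M)} (hdis : Disjoint X₁ X₂)
    (F : Finset (Fin d → ZMod M) → 𝕜) {Y₁ Y₂ : Finset (Fin d → ZMod M)} (hY₁ : Y₁ ∈ polys s X₁)
    (hY₂ : Y₂ ∈ polys s X₂) : bprod s F (Y₁ ∪ Y₂) = bprod s F Y₁ * bprod s F Y₂ :=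
  bprod_union F (mem_polys.1 hY₁).2 (mem_polys.1 hY₂).2
    (disjoint_of_subset_left (mem_polys.1 hY₁).1 (disjoint_of_subset_right (mem_polys.1 hY₂).1 hdis))

/-- **`Φ(X₁ ∪ X₂, φ, ξ) = Φ(X₁, φ, ξ) Φ(X₂, φ, ξ)`** for disjoint `k`-polymers on which `K` is
cross-multiplicative. [cite: AdamsBuchholzKoteckyMuller2019, Lemma 6.4 (5) ("the functional Φ factors on the scale k")] -/
theorem midK_union {s : ℕ} {X₁ X₂ : Finset (Fin d → ZMod M)} (hX₁ : IsPolymer s X₁)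
    (hX₂ : IsPolymer s X₂) (hdis : Disjoint X₁ X₂)
    {I It K : Finset (Fin d → ZMod M) → ((Fin d → ZMod M) → ℝ) → 𝕜} {φ ξ : (Fin d → ZMod M) → ℝ}
    (hK : ∀ Y₁ ∈ polys s X₁, ∀ Y₂ ∈ polys s X₂, K (Y₁ ∪ Y₂) (φ + ξ) = K Y₁ (φ + ξ) * K Y₂ (φ + ξ)) :
    midK s I It K (X₁ ∪ X₂) φ ξ = midK s I It K X₁ φ ξ * midK s I It K X₂ φ ξ := by
  unfold midK
  refine pcirc_union_of_mul hX₁ hX₂ hdis (fun Y₁ hY₁ Y₂ hY₂ => bprod_union_of_mem_polys hdis _ hY₁ hY₂)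
    fun Y₁ hY₁ Y₂ hY₂ => ?_
  have hd' : Disjoint Y₁ Y₂ :=
    disjoint_of_subset_left (mem_polys.1 hY₁).1 (disjoint_of_subset_right (mem_polys.1 hY₂).1 hdis)
  exact pcirc_union_of_mul (mem_polys.1 hY₁).2 (mem_polys.1 hY₂).2 hd'
    (fun Z₁ hZ₁ Z₂ hZ₂ => bprod_union_of_mem_polys hd' _ hZ₁ hZ₂)
    fun Z₁ hZ₁ Z₂ hZ₂ => hK Z₁ (polys_mono s (mem_polys.1 hY₁).1 hZ₁) Z₂ (polys_mono s (mem_polys.1 hY₂).1 hZ₂)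

/-! ## `Φ(X, φ, ·)` as a function of the fluctuation field: locality and measurability -/

/-- **Gauge-locality of `ξ ↦ Φ(X, φ, ξ)`** on any `S` on which `I(B,·)` (`B ∈ 𝓑_k(X)`) and `K(Y,·)`
(`Y ∈ 𝓟_k(X)`) are local. [cite: AdamsBuchholzKoteckyMuller2019, Lemma 6.4 (5) (proof)] -/
theorem isGaugeLocal_midK_snd {𝔥 R : ℝ} {p : ℕ} {S : Finset (Fin d → ZMod M)} {s : ℕ}
    {I It K : Finset (Fin d → ZMod M) → ((Fin d → ZMod M) → ℝ) → 𝕜} {X : Finset (Fin d → ZMod M)}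
    (hX : IsPolymer s X)
    (hI : ∀ B ∈ blocks s X, IsGaugeLocal (fieldGauge 𝔥 R p S) (I B))
    (hK : ∀ Y ∈ polys s X, IsGaugeLocal (fieldGauge 𝔥 R p S) (K Y)) (φ : (Fin d → ZMod M) → ℝ) :
    IsGaugeLocal (fieldGauge 𝔥 R p S) fun ξ => midK s I It K X φ ξ := by
  unfold midK
  have hblocks : ∀ Y ∈ polys s X, blocks s Y ⊆ blocks s X :=
    fun Y hY => blocks_mono s (mem_polys.1 hY).1
  have hsd : ∀ Y ∈ polys s X, X \ Y ∈ polys s X :=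
    fun Y hY => mem_polys.2 ⟨sdiff_subset, hX.sdiff (mem_polys.1 hY).2⟩
  have shift : ∀ {F : ((Fin d → ZMod M) → ℝ) → 𝕜}, IsGaugeLocal (fieldGauge 𝔥 R p S) F →
      IsGaugeLocal (fieldGauge 𝔥 R p S) fun ξ => F (φ + ξ) := fun hF => by
    have := hF.comp_add_right (fieldGauge 𝔥 R p S) φ
    simpa only [add_comm] using this
  refine isGaugeLocal_pcirc _ (fun Y hY => isGaugeLocal_const _ _) ?_
  intro Y hY
  have hXY := hsd Y hY
  refine isGaugeLocal_pcirc _ (fun Z hZ => isGaugeLocal_bprod _ fun B hB => ?_) ?_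
  · have hZX : Z ∈ polys s X := polys_mono s sdiff_subset hZ
    exact (shift (hI B (hblocks Z hZX hB))).op₂ _ (· - ·) (isGaugeLocal_const _ (1 : 𝕜))
  · intro Z hZ
    have hW : (X \ Y) \ Z ∈ polys s X :=
      mem_polys.2 ⟨sdiff_subset.trans sdiff_subset, (mem_polys.1 hXY).2.sdiff (mem_polys.1 hZ).2⟩
    exact shift (hK _ hW)

omit [NeZero M] in
/-- Small natural multi-indices have small sup-norm on the torus: `|β|_∞ ≤ p` if `β_i ≤ p`.
[cite: AdamsBuchholzKoteckyMuller2019, App. A.5] -/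
theorem supNorm_natVec_le [NeZero M] {p : ℕ} {β : Fin d → ℕ} (hβ : ∀ i, β i ≤ p) :
    GradientFRD.supNorm (fun i => ((β i : ℕ) : ZMod M)) ≤ p := by
  rw [supNorm_le_iff]
  intro i
  by_cases h : β i ≤ M / 2
  · rw [ZMod.valMinAbs_natCast_of_le_half h]; simpa using hβ i
  · exact (ZMod.natAbs_valMinAbs_le _).trans (by have := hβ i; omega)

/-- **Fields that agree on `S + [−p,p]^d` have the same gauge on `S`** (the stencil of `∇^α`,
`|α| ≤ p`, at `x ∈ S` lies in `x + [0,p]^d`). [cite: AdamsBuchholzKoteckyMuller2019, Ch. 6.4 (6.40)] -/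
theorem fieldGauge_eq_of_eqOn_thicken {𝔥 R : ℝ} {p : ℕ} {S : Finset (Fin d → ZMod M)}
    {ξ η : (Fin d → ZMod M) → ℝ} (h : ∀ y ∈ thicken p S, ξ y = η y) :
    fieldGauge 𝔥 R p S ξ = fieldGauge 𝔥 R p S η := by
  funext q
  rw [fieldGauge_apply, fieldGauge_apply]
  congr 1
  obtain ⟨⟨x, hx⟩, ⟨α, hα⟩⟩ := q
  have hαp : ∀ i, α i ≤ p := by
    intro i
    have h2 := (mem_diffIndex.1 hα).2
    exact le_trans (Finset.single_le_sum (f := α) (fun j _ => Nat.zero_le _) (mem_univ i)) h2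
  -- `∇^α (ξ − η)(x) = 0` by the stencil lemma
  have hsub : iterDiff α (ξ + (-1 : ℝ) • η) x = 0 := by
    refine iterDiff_apply_eq_zero α _ x fun β hβ => ?_
    have hmem : (x + fun i => ((β i : ℕ) : ZMod M)) ∈ thicken p S := by
      refine mem_thicken.2 ⟨x, hx, ?_⟩
      rw [add_sub_cancel_left]
      exact supNorm_natVec_le fun i => (hβ i).trans (hαp i)
    simp only [Pi.add_apply, Pi.smul_apply, smul_eq_mul, h _ hmem]
    ring
  rw [iterDiff_add, iterDiff_smul] at hsub
  simp only [Pi.add_apply, Pi.smul_apply, smul_eq_mul] at hsub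
  linarith

omit [NeZero M] in
/-- **Constant shifts do not change the gauge**: `T(ξ + c) = T ξ` (every `∇^α`, `|α| ≥ 1`, kills
constants). [cite: AdamsBuchholzKoteckyMuller2019, Lemma 6.3] -/
theorem fieldGauge_add_const [NeZero M] (𝔥 R : ℝ) (p : ℕ) (S : Finset (Fin d → ZMod M))
    (ξ : (Fin d → ZMod M) → ℝ) (c : ℝ) :
    fieldGauge 𝔥 R p S (ξ + fun _ => c) = fieldGauge 𝔥 R p S ξ := by
  rw [map_add]
  have : fieldGauge 𝔥 R p S (fun _ : Fin d → ZMod M => c) = 0 := by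
    funext q
    rw [fieldGauge_apply, Pi.zero_apply, iterDiff_const_eq_zero (mem_diffIndex.1 q.2.2).1 c]
    simp
  rw [this, add_zero]

/-- A gauge-local functional depends only on the field on `S + [−p,p]^d`.
[cite: AdamsBuchholzKoteckyMuller2019, Lemma 6.3] -/
theorem IsGaugeLocal.eq_of_eqOn_thicken {𝔸 : Type*} {𝔥 R : ℝ} {p : ℕ} {S : Finset (Fin d → ZMod M)}
    {F : ((Fin d → ZMod M) → ℝ) → 𝔸} (hF : IsGaugeLocal (fieldGauge 𝔥 R p S) F)
    (ξ η : (Fin d → ZMod M) → ℝ) (h : ∀ y ∈ thicken p S, ξ y = η y) : F ξ = F η :=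
  hF ξ η (fieldGauge_eq_of_eqOn_thicken h)

/-- A gauge-local functional is shift invariant. [cite: AdamsBuchholzKoteckyMuller2019, Lemma 6.3] -/
theorem IsGaugeLocal.add_const {𝔸 : Type*} {𝔥 R : ℝ} {p : ℕ} {S : Finset (Fin d → ZMod M)}
    {F : ((Fin d → ZMod M) → ℝ) → 𝔸} (hF : IsGaugeLocal (fieldGauge 𝔥 R p S) F)
    (ξ : (Fin d → ZMod M) → ℝ) (c : ℝ) : F (ξ + fun _ => c) = F ξ :=
  hF _ _ (fieldGauge_add_const 𝔥 R p S ξ c)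

/-- Measurability of block products in the field. [cite: AdamsBuchholzKoteckyMuller2019, Lemma 6.4 (5)] -/
theorem measurable_bprod {s : ℕ} {F : Finset (Fin d → ZMod M) → ((Fin d → ZMod M) → ℝ) → 𝕜}
    {X : Finset (Fin d → ZMod M)} (hF : ∀ B ∈ blocks s X, Measurable (F B)) :
    Measurable fun ξ => bprod s (fun B => F B ξ) X := by
  unfold bprod
  exact Finset.measurable_prod _ hF

/-- Measurability of circle products in the field. [cite: AdamsBuchholzKoteckyMuller2019, Lemma 6.4 (5)] -/
theorem measurable_pcirc {s : ℕ} {F G : Finset (Fin d → ZMod M) → ((Fin d → ZMod M) → ℝ) → 𝕜}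
    {X : Finset (Fin d → ZMod M)} (hF : ∀ Y ∈ polys s X, Measurable (F Y))
    (hG : ∀ Y ∈ polys s X, Measurable (G (X \ Y))) :
    Measurable fun ξ => pcirc s (fun Y => F Y ξ) (fun Y => G Y ξ) X := by
  unfold pcirc
  exact Finset.measurable_sum _ fun Y hY => (hF Y hY).mul (hG Y hY)

/-- **Measurability of `ξ ↦ Φ(X, φ, ξ)`** from measurability of `I(B, ·)` and `K(Y, ·)`.
[cite: AdamsBuchholzKoteckyMuller2019, Lemma 6.4 (5)] -/
theorem measurable_midK_snd {s : ℕ} {I It K : Finset (Fin d → ZMod M) → ((Fin d → ZMod M) → ℝ) → 𝕜}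
    {X : Finset (Fin d → ZMod M)} (hX : IsPolymer s X) (hI : ∀ B ∈ blocks s X, Measurable (I B))
    (hK : ∀ Y ∈ polys s X, Measurable (K Y)) (φ : (Fin d → ZMod M) → ℝ) :
    Measurable fun ξ => midK s I It K X φ ξ := by
  unfold midK
  have hadd : Measurable fun ξ : (Fin d → ZMod M) → ℝ => φ + ξ := measurable_const.add measurable_id
  refine measurable_pcirc (fun Y _ => measurable_const) fun Y hY => ?_
  have hXY : X \ Y ∈ polys s X := mem_polys.2 ⟨sdiff_subset, hX.sdiff (mem_polys.1 hY).2⟩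
  refine measurable_pcirc (fun Z hZ => measurable_bprod fun B hB => ?_) fun Z hZ => ?_
  · have hZX : Z ∈ polys s X := polys_mono s sdiff_subset hZ
    exact ((hI B (blocks_mono s (mem_polys.1 hZX).1 hB)).comp hadd).sub measurable_const
  · have hW : (X \ Y) \ Z ∈ polys s X :=
      mem_polys.2 ⟨sdiff_subset.trans sdiff_subset, (mem_polys.1 hXY).2.sdiff (mem_polys.1 hZ).2⟩
    exact (hK _ hW).comp hadd

/-! ## Lemma 6.4 (5) -/

omit [NeZero M] in
/-- A thickening of `U₁` by `r'` does not meet `U₂` when `dist(U₁, U₂) > r'`.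
[cite: AdamsBuchholzKoteckyMuller2019, Lemma 6.4 (5) (proof: X₁ ∩ U₂ = ∅)] -/
theorem disjoint_thicken_of_separated [NeZero M] {r' D : ℕ} (hD : r' + 1 ≤ D)
    {U₁ U₂ : Finset (Fin d → ZMod M)} (hsep : Separated D U₁ U₂) : Disjoint (thicken r' U₁) U₂ := by
  rw [Finset.disjoint_left]
  intro x hx hxU₂
  obtain ⟨u, hu, hxu⟩ := mem_thicken.1 hx
  have := hsep u hu x hxU₂
  rw [supNorm_sub_comm] at this
  omega

/-- **Lemma 6.4 (5): `K_{k+1}` factors over strictly disjoint `(k+1)`-polymers.**  Setting: odd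
torus `M = s·t`, `s = L^k`, reblocking map `π = reblock s (L s)` ((6.25)–(6.26)), fluctuation
measure `μ_{k+1} = N(0, circulant 𝒞)` with an even zero-sum kernel, positive on mean-zero fields
and constant `= m ≤ 0` beyond the range `ρ` (clauses (o), (i), (iii) of `GradientFRD.TorusFRD`);
radii: `K(Y, ·)` gauge-local on `Y + [−r,r]^d` (gauge order `p`), `X + [−r,r]^d ⊆ π(X) + [−r',r']^d`
via `r ≤ r'`, `r + (2^d−1)s ≤ r'` ((6.28)); `U₁, U₂ ∈ 𝓟_{k+1}` with `dist_∞(U₁, U₂) ≥ D` where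
`D ≥ 2r' + 2`, `D ≥ 2r' + s + 1`, `D ≥ 2r' + 2p + ρ` ((6.21): for strictly disjoint `(k+1)`-polymers
`D = L^{k+1} + 1` and these hold once `L ≥ 2^{d+2} + 4p + …`).  Hypotheses on the functionals:
`I(B, ·)` gauge-local on every `S ⊇ B` and measurable (e.g. `e^{−H(B,·)}`), `K(Y, ·)` measurable,
and `K` factors over `(s+1)`-separated `k`-polymers.  Conclusion:
`K_{k+1}(U₁ ∪ U₂, φ) = K_{k+1}(U₁, φ) · K_{k+1}(U₂, φ)`.
[cite: AdamsBuchholzKoteckyMuller2019, Lemma 6.4 (5)] -/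
theorem nextK_union {s t L r r' D p ρ : ℕ} {𝔥 R : ℝ} (h𝔥 : 𝔥 ≠ 0) (hR : R ≠ 0)
    (hMst : M = s * t) (hs : Odd s) (ht : Odd t) (hL : Odd L)
    (hrr : r ≤ r') (hr : r + (2 ^ d - 1) * s ≤ r')
    (hD : 2 * r' + 2 ≤ D) (hDs : 2 * r' + (s + 1) ≤ D) (hDρ : 2 * r' + 2 * p + ρ ≤ D)
    {𝒞 : (Fin d → ZMod M) → ℝ} (h0 : ∑ x, 𝒞 x = 0) (heven : ∀ x, 𝒞 (-x) = 𝒞 x)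
    (hpos : ∀ φ : (Fin d → ZMod M) → ℝ, ∑ x, φ x = 0 → 0 ≤ ∑ x, ∑ y, φ x * 𝒞 (x - y) * φ y)
    {m : ℝ} (hm : m ≤ 0) (hrange : ∀ x, ρ ≤ GradientFRD.supNorm x → 𝒞 x = m)
    {I It K : Finset (Fin d → ZMod M) → ((Fin d → ZMod M) → ℝ) → 𝕜}
    (hIloc : ∀ B S, B ⊆ S → IsGaugeLocal (fieldGauge 𝔥 R p S) (I B))
    (hImeas : ∀ B, Measurable (I B))
    (hKloc : ∀ Y, IsPolymer s Y → IsGaugeLocal (fieldGauge 𝔥 R p (thicken r Y)) (K Y))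
    (hKmeas : ∀ Y, Measurable (K Y))
    (hKfac : ∀ Y₁ Y₂, IsPolymer s Y₁ → IsPolymer s Y₂ → Separated (s + 1) Y₁ Y₂ →
      ∀ φ, K (Y₁ ∪ Y₂) φ = K Y₁ φ * K Y₂ φ)
    {U₁ U₂ : Finset (Fin d → ZMod M)} (hU₁ : IsPolymer (L * s) U₁) (hU₂ : IsPolymer (L * s) U₂)
    (hsep : Separated D U₁ U₂) (φ : (Fin d → ZMod M) → ℝ) :
    nextK s (reblock s (L * s)) (stepMeasure 𝒞) I It K (U₁ ∪ U₂) φ =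
      nextK s (reblock s (L * s)) (stepMeasure 𝒞) I It K U₁ φ *
        nextK s (reblock s (L * s)) (stepMeasure 𝒞) I It K U₂ φ := by
  unfold nextK
  rw [sum_reblock_eq_union hMst hs ht hL hrr hr hD hsep hU₁ hU₂, Finset.sum_mul_sum]
  refine Finset.sum_congr rfl fun X₁ hX₁ => Finset.sum_congr rfl fun X₂ hX₂ => ?_
  obtain ⟨hX₁p, hπ₁⟩ := mem_filter.1 hX₁
  obtain ⟨hX₂p, hπ₂⟩ := mem_filter.1 hX₂
  have hX₁P : IsPolymer s X₁ := (mem_polys.1 hX₁p).2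
  have hX₂P : IsPolymer s X₂ := (mem_polys.1 hX₂p).2
  have hU₁s : IsPolymer s U₁ := hU₁.of_mul hs hL
  have hU₂s : IsPolymer s U₂ := hU₂.of_mul hs hL
  -- geometry of the pieces
  have hX₁rU : thicken r X₁ ⊆ thicken r' U₁ := by
    rw [← hπ₁]; exact thicken_subset_thicken_reblock hMst hs ht hL hrr hr X₁
  have hX₂rU : thicken r X₂ ⊆ thicken r' U₂ := by
    rw [← hπ₂]; exact thicken_subset_thicken_reblock hMst hs ht hL hrr hr X₂
  have hX₁U : X₁ ⊆ thicken r' U₁ := (subset_thicken r _).trans hX₁rU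
  have hX₂U : X₂ ⊆ thicken r' U₂ := (subset_thicken r _).trans hX₂rU
  have hsepX : Separated (D - 2 * r') X₁ X₂ := by
    have h : Separated (D - 2 * r') (thicken r' U₁) (thicken r' U₂) :=
      Separated.thicken (hsep.of_le (by omega))
    exact h.mono hX₁U hX₂U
  have hdisX : Disjoint X₁ X₂ := hsepX.disjoint (by omega)
  have hX₁U₂ : Disjoint X₁ U₂ :=
    disjoint_of_subset_left hX₁U (disjoint_thicken_of_separated (by omega) hsep)
  have hX₂U₁ : Disjoint X₂ U₁ :=
    disjoint_of_subset_left hX₂U (disjoint_thicken_of_separated (by omega) hsep.symm)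
  have hU₁U₂ : Disjoint U₁ U₂ := hsep.disjoint (by omega)
  -- (6.39): the prefactors split
  have e1 : (U₁ ∪ U₂) \ (X₁ ∪ X₂) = (U₁ \ X₁) ∪ (U₂ \ X₂) := by
    ext x
    simp only [mem_sdiff, mem_union, not_or]
    constructor
    · rintro ⟨h1 | h2, hn1, hn2⟩
      · exact Or.inl ⟨h1, hn1⟩
      · exact Or.inr ⟨h2, hn2⟩
    · rintro (⟨h1, hn1⟩ | ⟨h2, hn2⟩)
      · exact ⟨Or.inl h1, hn1, fun h => Finset.disjoint_left.1 hX₂U₁ h h1⟩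
      · exact ⟨Or.inr h2, fun h => Finset.disjoint_left.1 hX₁U₂ h h2, hn2⟩
  have e2 : (X₁ ∪ X₂) \ (U₁ ∪ U₂) = (X₁ \ U₁) ∪ (X₂ \ U₂) := by
    ext x
    simp only [mem_sdiff, mem_union, not_or]
    constructor
    · rintro ⟨h1 | h2, hn1, hn2⟩
      · exact Or.inl ⟨h1, hn1⟩
      · exact Or.inr ⟨h2, hn2⟩
    · rintro (⟨h1, hn1⟩ | ⟨h2, hn2⟩)
      · exact ⟨Or.inl h1, hn1, fun h => Finset.disjoint_left.1 hX₁U₂ h1 h⟩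
      · exact ⟨Or.inr h2, fun h => Finset.disjoint_left.1 hX₂U₁ h2 h, hn2⟩
  rw [e1, e2, bprod_union _ (hU₁s.sdiff hX₁P) (hU₂s.sdiff hX₂P)
      (disjoint_of_subset_left sdiff_subset (disjoint_of_subset_right sdiff_subset hU₁U₂)),
    bprod_union _ (hX₁P.sdiff hU₁s) (hX₂P.sdiff hU₂s)
      (disjoint_of_subset_left sdiff_subset (disjoint_of_subset_right sdiff_subset hdisX)),
    mul_inv]
  -- (6.36): `Φ(X₁ ∪ X₂) = Φ(X₁) Φ(X₂)` under the integral
  have hmid : (fun ξ => midK s I It K (X₁ ∪ X₂) φ ξ) =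
      fun ξ => midK s I It K X₁ φ ξ * midK s I It K X₂ φ ξ := by
    funext ξ
    refine midK_union hX₁P hX₂P hdisX fun Y₁ hY₁ Y₂ hY₂ => ?_
    refine hKfac Y₁ Y₂ (mem_polys.1 hY₁).2 (mem_polys.1 hY₂).2 ?_ (φ + ξ)
    exact (hsepX.mono (mem_polys.1 hY₁).1 (mem_polys.1 hY₂).1).of_le (by omega)
  rw [hmid]
  -- (6.38): the finite-range factorisation of the fluctuation integral
  have hloc : ∀ {X U : Finset (Fin d → ZMod M)}, IsPolymer s X → thicken r X ⊆ thicken r' U →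
      IsGaugeLocal (fieldGauge 𝔥 R p (thicken r X)) fun ξ => midK s I It K X φ ξ :=
    fun {X U} hXP _ => isGaugeLocal_midK_snd hXP
      (fun B hB => hIloc B _ ((hXP.subset_of_mem_blocks hB).trans (subset_thicken r X)))
      (fun Y hY => (hKloc Y (mem_polys.1 hY).2).fieldGauge_mono h𝔥 hR
        (thicken_mono r (mem_polys.1 hY).1)) φ
  have hsepD : Separated ρ (thicken p (thicken r X₁)) (thicken p (thicken r X₂)) := by
    have h : Separated (ρ + (p + r') + (p + r')) U₁ U₂ := hsep.of_le (by omega)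
    have h2 : Separated ρ (thicken (p + r') U₁) (thicken (p + r') U₂) := Separated.thicken h
    exact h2.mono ((thicken_mono p hX₁rU).trans (thicken_thicken p r' U₁))
      ((thicken_mono p hX₂rU).trans (thicken_thicken p r' U₂))
  have hF := hloc hX₁P hX₁rU
  have hG := hloc hX₂P hX₂rU
  rw [integral_stepMeasure_mul_eq h0 heven hpos hm hrange hsepD
    (fun ξ η h => hF.eq_of_eqOn_thicken ξ η h) (fun ξ η h => hG.eq_of_eqOn_thicken ξ η h)
    (fun ξ c => hF.add_const ξ c) (fun ξ c => hG.add_const ξ c)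
    (measurable_midK_snd hX₁P (fun B _ => hImeas B) (fun Y _ => hKmeas Y) φ)
    (measurable_midK_snd hX₂P (fun B _ => hImeas B) (fun Y _ => hKmeas Y) φ)]
  ring

end Literature.MathematicalPhysics.StatisticalMechanics.GradientRG

end
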